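import Summits.QuantumFields.YangMills.Theorems.FluctuationComparisonRegPrIntLOrganTangentSmallStepWindowPath
import Summits.QuantumFields.YangMills.Theorems.BackwardLiouvilleRigidityFlatRatioTerminationInnerWindowGaugeSmall
import Summits.QuantumFields.YangMills.Theorems.BackwardLiouvilleRigidityFlatRatioTerminationThresholds
import Summits.QuantumFields.YangMills.Theorems.BackwardLiouvilleRigidityFlatRatioTerminationChordContraction
import Summits.QuantumFields.YangMills.Theorems.BackwardLiouvilleRigidityFlatRatioTerminationOneBondChains
import Literature.MathematicalPhysics.QuantumFieldTheory.Balaban1983to89.B12RegularClassInvariance263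
import Mathlib.Analysis.SpecialFunctions.Trigonometric.Bounds
import HarnessLib

/-!
# SMALL-STEP CHORD PATHS: VOLUME-UNIFORM PER-BOND MULTIPLICITY INSIDE THE STANDARD WINDOW (LEAD-20520 w3 g24 WORD №4 (P-b′)), DEFINITION-FREE

Cell `ym3-torus` (YM ladder rung R3 = continuum `SU(2)` Yang–Mills on the three-torus — a RUNG, NOT d = 4, NOT infinite volume, NOT a mass gap,
NOT Clay).  Width seat `ym-ust-20520-w4` (gen 22); `--supports stmt-QuantumFields-20520 --as helper`, count-neutral, definition-free, default
heartbeats; no registry, binder or `Lines/` edit; the registered skeleton `Lines/semiclassical_s2beta.lean` v11.4 and its five stubs are untouched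
(0∕5, ★★OWNER RULING №36).  v18-TEXT-INDEPENDENT.

WHY.  ✓(P-b) `…OrganTangentSmallStepWindowPath.exists_smallStep_windowPath` composes ✓S4a BY NAME and therefore inherits S4a's EXPORT: only the TOTAL
count `≤ #PBond²` of one-bond changes (so the per-bond multiplicity of the small-step path is volume-dependent) and the OUTER window tripled (`3·θ`).
LEAD's `V18-TYPING-SPEC-w3g24.md` §4 (b) asks a per-bond multiplicity `N` uniform in the volume (it is the `1∕θ`-type constant of S3's right-hand
side).  THIS FILE re-exports the CHORD-SWEEP internals of S4a (✓`…FlatRatioTerminationChordContraction`, ✓`…OneBondChains`, ✓`stub_innerWindowGaugeSmall`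
p679507, ✓`stub_thresholds` p652443) with the multiplicity tracked, and WITHOUT the gauge leg: the path ends at the SMALL-GAUGE COPY `U^u` of `U`
(for a gauge-invariant functional — the organ's remainder, ✓p794698 — that is the same datum).

WHAT.  §0 ★`exists_subdivision_of_dist1_le_sharp`: ✓p797395's τ-form with the θ-FREE count `n ≤ (π∕2)τ∕δ + 2` (`‖log g‖ ≤ (π∕2)·dist1 g`, Jordan).
§1 ★`exists_sweep_path`: ONE SWEEP — from a `θ₀`-small configuration `V` to `e ↦ k e · V e` (`dist1 (k e) ≤ s`), changing the bonds one at a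
time in a fixed enumeration and subdividing each change by ✓(P-a) `exists_subdivision_of_dist1_le`: a path of right exponential moves of size `≤ δ`
touching EVERY BOND AT MOST `⌈(π∕2)s∕δ⌉₊ + 2` TIMES (θ-free count, §0), all prefixes `(θ₀ + 8s)`-small.  §2 ★★`exists_smallStep_chordPath_gaugeCopy`: in S4a's regime
(`∃ pW, ∀ p₀ ≥ pW, ∀ F γ b₀, …, ∃ jW, ∀ j ≥ jW`), for `U` in the inner window `θBal(√b₀, p₀∕2)` and every `δ > 0`: a gauge transformation `u` and a
path from `1` to `U^u` of right exponential one-bond moves of size `≤ δ`, per-bond multiplicity `≤ ⌈1∕η⌉₊ · (⌈(3π∕4)η²∕δ⌉₊ + 2)` with `η := √θ∕16`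
(VOLUME-UNIFORM; `= 3⌈16∕√θ⌉₊` as soon as `δ ≥ (3π∕4)η²`), ALL prefixes inside the STANDARD window `PlaqSmall θ`, `θ := θBal F.L γ b₀ p₀ j` (no factor 3), and every probe-moved prefix in
`PlaqSmall (θ + 4·dist1 (expPt w))`.  Mechanism = S4a's: `M := ⌈1∕η⌉₊` chord configurations `C_k e := quatToSU2 (1 + (k∕M)(su2Quat (U^u e) − 1))`
(each `(θ_in + 16η²)`-small, consecutive ones bondwise within `3η²∕2`), one sweep (§1) per `k`, prefixes `(θ_in + 28η²)`-small `⊆ PlaqSmall θ`.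

HONEST FRAMING: lattice∕Lie-group bookkeeping over landed lemmas (all the geometry is S4a's, ym-idea-1 lineage); nothing of Bałaban's renormalisation-group
analysis is asserted; TN-GR (v), O1∕O1ᵘ-H, the crux `FluctuationComparisonRegPrIntL` (stmt-QuantumFields-20520) and `YM3TorusSU2` are NOT proved; no summit ∕
sub-problem statement is proved; rung R3 = SU(2) YM₃ on T³ — NOT d = 4, NOT infinite volume, NOT a mass gap, NOT Clay; the Yang–Mills mass gap is NOT proved.
[cite: Balaban1985Averaging, (8)-(9) p.19; Balaban1987RG1, (0.18) p.255]
-/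

set_option autoImplicit false

noncomputable section

namespace Summit.QuantumFields.YangMills.Theorems.OrganTangentSmallStepChordPath

open Function
open scoped Quaternion
open Literature.MathematicalPhysics.QuantumFieldTheory
open Literature.MathematicalPhysics.QuantumFieldTheory.Balaban1983to89
open Literature.MathematicalPhysics.QuantumFieldTheory.Balaban1983to89.T3ContinuumYM3Torus
open Literature.MathematicalPhysics.QuantumFieldTheory.Balaban1983to89.T3UnitScaleTilt (θBal)
open Literature.MathematicalPhysics.QuantumLattice (su2Quat quatToSU2 quatToSU2_su2Quat norm_su2Quat)
open T4CubeChartGnomonic (SU2)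
open T4CubeChartExp (expPt expPt_zero)
open T4HaarSU2ExpChart (expPoint)
open T4ExpWindowSmallField (logVec expPoint_logVec norm_logVec_le_pi dist1_eq_two_mul_sin plaqSmall_of_bdev_le)
open Summit.QuantumFields.YangMills.Theorems.OrganTangentSmallStepOneBond (exists_subdivision_of_dist1_le dist1_bdev_update_le
  dist1_expPoint_smul_logVec_le expPt_smul_ofLp)
open Summit.QuantumFields.YangMills.Theorems.OrganTangentSmallStepWindowPath (foldl_replicate_move)
open Summit.QuantumFields.YangMills.Theorems.FlatRatioTermination (dist1_plaqHol_mul_le dist1_plaqHol_chord_le dist1_chordStep_le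
  stub_innerWindowGaugeSmall stub_thresholds)

/-! ## §0 The θ-free subdivision count (Jordan's inequality) -/

section Sharp

/-- **THE LOGARITHM IS CONTROLLED BY `dist1`**: `‖logVec (su2Quat g)‖ ≤ (π∕2)·dist1 g` (`dist1 g = 2 sin(‖log‖∕2)`, `‖log‖ ≤ π`, and Jordan's
`sin t ≥ (2∕π) t` on `[0, π∕2]`, Mathlib `Real.mul_le_sin`). [folklore] -/
theorem norm_logVec_le_mul_dist1 (g : SU2) : ‖logVec (su2Quat g)‖ ≤ Real.pi / 2 * dist1 g := by
  have hx := norm_logVec_le_pi (su2Quat g)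
  have h0 : 0 ≤ ‖logVec (su2Quat g)‖ / 2 := by positivity
  have h1 : ‖logVec (su2Quat g)‖ / 2 ≤ Real.pi / 2 := by linarith
  have hJ := Real.mul_le_sin h0 h1
  rw [dist1_eq_two_mul_sin g]
  have hπ : 0 < Real.pi := Real.pi_pos
  -- (2/π)·(‖x‖/2) ≤ sin(‖x‖/2) ⇒ ‖x‖ ≤ π · sin(‖x‖∕2) = (π/2)·(2 sin(‖x‖/2))
  have hre : 2 / Real.pi * (‖logVec (su2Quat g)‖ / 2) = ‖logVec (su2Quat g)‖ / Real.pi := by ring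
  have h2 : ‖logVec (su2Quat g)‖ / Real.pi ≤ Real.sin (‖logVec (su2Quat g)‖ / 2) := by rw [← hre]; exact hJ
  calc ‖logVec (su2Quat g)‖ = Real.pi * (‖logVec (su2Quat g)‖ / Real.pi) := by field_simp
    _ ≤ Real.pi * Real.sin (‖logVec (su2Quat g)‖ / 2) := mul_le_mul_of_nonneg_left h2 hπ.le
    _ = Real.pi / 2 * (2 * Real.sin (‖logVec (su2Quat g)‖ / 2)) := by ring

variable {P : Params} {j : ℕ} [DecidableEq (PBond P j)]

/-- ★ **SMALL-STEP SUBDIVISION WITH THE θ-FREE COUNT**: as ✓p797395 `exists_subdivision_of_dist1_le` (`U` `θ₁`-small, `dist1 g ≤ τ`, `δ > 0`), but with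
`n ≤ (π∕2)·τ∕δ + 2` pieces instead of `π∕δ + 2` — the logarithm of a `τ`-small group element has norm `≤ (π∕2)τ`, so a move that is ALREADY small needs
few pieces.  [cite: Balaban1985Averaging, (8)-(9) p.19] -/
theorem exists_subdivision_of_dist1_le_sharp {θ₁ τ δ : ℝ} (U : GaugeField P j SU2) (b : PBond P j) (g : SU2)
    (hU : PlaqSmall θ₁ U) (hg : dist1 g ≤ τ) (hδ : 0 < δ) :
    ∃ (n : ℕ) (v : Fin 3 → ℝ), 0 < n ∧ (n : ℝ) ≤ Real.pi / 2 * τ / δ + 2 ∧ ‖v‖ ≤ δ ∧ expPt ((n : ℝ) • v) = g ∧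
      (∀ k : ℕ, k ≤ n → dist1 (expPt ((k : ℝ) • v)) ≤ dist1 g) ∧
      ∀ k : ℕ, k ≤ n → PlaqSmall (θ₁ + 4 * τ) (update U b (U b * expPt ((k : ℝ) • v))) := by
  set x : EuclideanSpace ℝ (Fin 3) := logVec (su2Quat g) with hx
  have hτ0 : 0 ≤ τ := (GaugeGroup.dist1_nonneg g).trans hg
  have hxτ : ‖x‖ ≤ Real.pi / 2 * τ :=
    (norm_logVec_le_mul_dist1 g).trans (mul_le_mul_of_nonneg_left hg (by positivity))
  set n : ℕ := ⌈Real.pi / 2 * τ / δ⌉₊ + 1 with hn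
  have hn0 : 0 < n := Nat.succ_pos _
  have hnR : (0 : ℝ) < n := by exact_mod_cast hn0
  have hceil : Real.pi / 2 * τ / δ ≤ (⌈Real.pi / 2 * τ / δ⌉₊ : ℝ) := Nat.le_ceil _
  have hnlt : Real.pi / 2 * τ / δ < n := by rw [hn]; push_cast; linarith
  have hnle : (n : ℝ) ≤ Real.pi / 2 * τ / δ + 2 := by
    rw [hn]; push_cast
    linarith [Nat.ceil_lt_add_one (show 0 ≤ Real.pi / 2 * τ / δ by positivity)]
  set w : Fin 3 → ℝ := WithLp.ofLp x with hw
  have hwle : ‖w‖ ≤ Real.pi / 2 * τ := by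
    refine (pi_norm_le_iff_of_nonneg (by positivity)).2 fun i => ?_
    rw [Real.norm_eq_abs]
    exact (T4ExpWindowSmallField.abs_logVec_apply_le _ i).trans hxτ
  have hpart : ∀ k : ℕ, expPt ((k : ℝ) • ((n : ℝ)⁻¹ • w)) = expPoint (((k : ℝ) * (n : ℝ)⁻¹) • x) := by
    intro k; rw [smul_smul, hw, expPt_smul_ofLp]
  have hdist : ∀ k : ℕ, k ≤ n → dist1 (expPt ((k : ℝ) • ((n : ℝ)⁻¹ • w))) ≤ dist1 g := by
    intro k hk
    rw [hpart]
    refine dist1_expPoint_smul_logVec_le g (by positivity) ?_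
    rw [mul_inv_le_iff₀ hnR, one_mul]; exact_mod_cast hk
  refine ⟨n, (n : ℝ)⁻¹ • w, hn0, hnle, ?_, ?_, hdist, ?_⟩
  · rw [norm_smul, norm_inv, Real.norm_natCast, inv_mul_le_iff₀ hnR]
    have : Real.pi / 2 * τ < n * δ := by rwa [div_lt_iff₀ hδ] at hnlt
    linarith
  · rw [smul_smul, mul_inv_cancel₀ hnR.ne', one_smul, hw, show (WithLp.ofLp x : Fin 3 → ℝ) = (1 : ℝ) • WithLp.ofLp x from (one_smul _ _).symm,
      expPt_smul_ofLp, one_smul, hx, expPoint_logVec]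
  · intro k hk
    exact plaqSmall_of_bdev_le hU fun e => (dist1_bdev_update_le U b _ e).trans ((hdist k hk).trans hg)

end Sharp

/-! ## §1 One sweep: change every bond once, in small steps -/

section Sweep

variable {P : Params} {j : ℕ} [DecidableEq (PBond P j)]

/-- ★ **ONE SWEEP IN SMALL STEPS.**  `V` `θ₀`-small, left factors `k e` within `s` of `1`, `δ > 0`: a path of right exponential one-bond moves
`W ↦ update W q.1 (W q.1 · expPt q.2)` of size `‖q.2‖ ≤ δ` from `V` to `e ↦ k e · V e`, touching every bond at most `⌈(π∕2)s∕δ⌉₊ + 2` times, with every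
prefix configuration `(θ₀ + 8s)`-small (the hybrids `e ↦ (ι e < i ? k e · V e : V e)` are `(θ₀ + 4s)`-small by ✓`dist1_plaqHol_mul_le`; each
one-bond change, a conjugate of `k e`, is subdivided by ✓`exists_subdivision_of_dist1_le`). [cite: Balaban1985Averaging, (8)-(9) p.19] -/
theorem exists_sweep_path {θ₀ s δ : ℝ} (hs : 0 ≤ s) (hδ : 0 < δ) (V : GaugeField P j SU2) (hV : PlaqSmall θ₀ V)
    (k : PBond P j → SU2) (hk : ∀ e, dist1 (k e) ≤ s) :
    ∃ path : List (PBond P j × (Fin 3 → ℝ)),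
      (∀ q ∈ path, ‖q.2‖ ≤ δ) ∧
      (∀ b : PBond P j, path.countP (fun q => decide (q.1 = b)) ≤ ⌈Real.pi / 2 * s / δ⌉₊ + 2) ∧
      List.foldl (fun (W : GaugeField P j SU2) (q : PBond P j × (Fin 3 → ℝ)) => update W q.1 (W q.1 * expPt q.2)) V path =
        (fun e => k e * V e) ∧
      ∀ m : ℕ, m ≤ path.length → PlaqSmall (θ₀ + 8 * s)
        (List.foldl (fun (W : GaugeField P j SU2) (q : PBond P j × (Fin 3 → ℝ)) => update W q.1 (W q.1 * expPt q.2)) V (path.take m)) := by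
  classical
  set B : ℕ := Fintype.card (PBond P j) with hB
  set ι : PBond P j ≃ Fin B := Fintype.equivFin (PBond P j) with hι
  set N : ℕ := ⌈Real.pi / 2 * s / δ⌉₊ + 2 with hN
  set mv : GaugeField P j SU2 → PBond P j × (Fin 3 → ℝ) → GaugeField P j SU2 := fun W q => update W q.1 (W q.1 * expPt q.2) with hmv
  -- the hybrids
  set H : ℕ → GaugeField P j SU2 := fun i e => if (ι e : ℕ) < i then k e * V e else V e with hH
  have hHwin : ∀ i, PlaqSmall (θ₀ + 4 * s) (H i) := by
    intro i p
    have heq : H i = fun e => (if (ι e : ℕ) < i then k e else 1) * V e := by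
      funext e; simp only [hH]; by_cases h : (ι e : ℕ) < i <;> simp [h]
    rw [heq]
    have := dist1_plaqHol_mul_le V (fun e => if (ι e : ℕ) < i then k e else 1) (s := s)
      (fun e => by by_cases h : (ι e : ℕ) < i <;> simp [h, hk e, hs, GaugeGroup.dist1_one]) p
    linarith [hV p]
  -- one step of the sweep: bond `ι.symm i` changes from `V` to `k · V`
  have hstep : ∀ i : ℕ, ∀ hi : i < B,
      H (i + 1) = update (H i) (ι.symm ⟨i, hi⟩) (H i (ι.symm ⟨i, hi⟩) * ((V (ι.symm ⟨i, hi⟩))⁻¹ * k (ι.symm ⟨i, hi⟩) * V (ι.symm ⟨i, hi⟩))) := by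
    intro i hi
    funext e
    by_cases he : e = ι.symm ⟨i, hi⟩
    · subst he
      have hιe : (ι (ι.symm ⟨i, hi⟩) : ℕ) = i := by simp
      rw [update_self]
      simp only [hH, hιe, lt_irrefl, if_false, Nat.lt_succ_self, if_true]
      group
    · rw [update_of_ne he]
      have hne : (ι e : ℕ) ≠ i := by
        intro h; apply he
        rw [← ι.symm_apply_apply e]; congr 1; exact Fin.ext h
      simp only [hH]
      by_cases h : (ι e : ℕ) < i
      · simp [h, show (ι e : ℕ) < i + 1 by omega]
      · simp [h, show ¬ ((ι e : ℕ) < i + 1) by omega]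
  -- induction over the bonds
  have build : ∀ i : ℕ, i ≤ B → ∃ path : List (PBond P j × (Fin 3 → ℝ)),
      (∀ q ∈ path, ‖q.2‖ ≤ δ) ∧
      (∀ b : PBond P j, path.countP (fun q => decide (q.1 = b)) ≤ if (ι b : ℕ) < i then N else 0) ∧
      List.foldl mv V path = H i ∧
      ∀ m : ℕ, m ≤ path.length → PlaqSmall (θ₀ + 8 * s) (List.foldl mv V (path.take m)) := by
    intro i
    induction i with
    | zero =>
      intro _
      refine ⟨[], by simp, by simp, ?_, ?_⟩
      · rw [List.foldl_nil]; funext e; simp [hH]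
      · intro m _
        rw [List.take_nil, List.foldl_nil]
        exact fun p => (hV p).trans_le (by linarith)
    | succ i ih =>
      intro hi
      have hi' : i < B := Nat.lt_of_succ_le hi
      obtain ⟨path, hsz, hcnt, hfold, hpre⟩ := ih hi'.le
      set b : PBond P j := ι.symm ⟨i, hi'⟩ with hb
      set g : SU2 := (V b)⁻¹ * k b * V b with hg
      have hgd : dist1 g ≤ s := by
        rw [hg, show (V b)⁻¹ * k b * V b = (V b)⁻¹ * k b * (V b)⁻¹⁻¹ by rw [inv_inv], GaugeGroup.dist1_conj]
        exact hk b
      obtain ⟨n, v, hn0, hnle, hv, hng, hdist, hpart⟩ := exists_subdivision_of_dist1_le_sharp (H i) b g (hHwin i) hgd hδ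
      have hnN : n ≤ N := by
        have h1 : (n : ℝ) ≤ (⌈Real.pi / 2 * s / δ⌉₊ : ℝ) + 2 := hnle.trans (by linarith [Nat.le_ceil (Real.pi / 2 * s / δ)])
        rw [hN]; exact_mod_cast h1
      refine ⟨path ++ List.replicate n (b, v), ?_, ?_, ?_, ?_⟩
      · intro q hq
        rcases List.mem_append.1 hq with hq | hq
        · exact hsz q hq
        · rw [List.eq_of_mem_replicate hq]; exact hv
      · intro b'
        rw [List.countP_append, List.countP_replicate]
        have hιb : (ι b : ℕ) = i := by simp [hb]
        by_cases hbb : b = b'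
        · subst hbb
          have hprev := hcnt b
          rw [hιb, if_neg (lt_irrefl i)] at hprev
          simp only [decide_true, if_true, hιb, Nat.lt_succ_self]
          omega
        · have hne : ¬ ((b, v).1 = b') := hbb
          simp only [decide_eq_true_eq, hne, if_false, add_zero]
          refine (hcnt b').trans ?_
          by_cases h : (ι b' : ℕ) < i
          · simp [h, show (ι b' : ℕ) < i + 1 by omega]
          · have : (ι b' : ℕ) ≠ i := by
              intro h'; apply hbb
              rw [hb, ← ι.symm_apply_apply b']; congr 1; exact Fin.ext h'.symm
            simp [h, show ¬ ((ι b' : ℕ) < i + 1) by omega]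
      · rw [List.foldl_append, hfold, hmv, foldl_replicate_move, hng, ← hstep i hi']
      · intro m hm
        by_cases hml : m ≤ path.length
        · rw [List.take_append_of_le_length hml]; exact hpre m hml
        · have hml' : path.length ≤ m := le_of_lt (not_le.1 hml)
          rw [List.take_append, List.take_of_length_le hml', List.foldl_append, hfold, List.take_replicate, hmv,
            foldl_replicate_move]
          have := hpart _ (min_le_right (m - path.length) n)
          have h48 : θ₀ + 4 * s + 4 * s = θ₀ + 8 * s := by ring
          rw [h48] at this; exact this
  obtain ⟨path, hsz, hcnt, hfold, hpre⟩ := build B le_rfl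
  refine ⟨path, hsz, fun b => (hcnt b).trans (by split_ifs <;> omega), ?_, hpre⟩
  rw [hfold]; funext e; simp [hH, (ι e).isLt]

end Sweep

/-! ## §2 The chord sweeps from `1` to the small-gauge copy -/

section Chord

/-- ★★ **SMALL-STEP CHORD PATHS WITH VOLUME-UNIFORM MULTIPLICITY INSIDE THE STANDARD WINDOW** (see the module docstring).
[cite: Balaban1985Averaging, (8)-(9) p.19; Balaban1987RG1, (0.18) p.255] -/
theorem exists_smallStep_chordPath_gaugeCopy :
    ∃ pW : ℝ, ∀ (p₀ : ℝ), pW ≤ p₀ → ∀ (F : T3Family) (γ b₀ : ℝ), 0 < γ → γ ≤ 1 → 0 < b₀ → ∃ jW : ℕ, ∀ j : ℕ, jW ≤ j →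
      ∀ U : GaugeField (F.P j) 0 ↥(Matrix.specialUnitaryGroup (Fin 2) ℂ), PlaqSmall (θBal F.L γ (Real.sqrt b₀) (p₀ / 2) j) U →
        ∀ δ : ℝ, 0 < δ → ∀ [DecidableEq (PBond (F.P j) 0)],
          ∃ (u : GaugeTransf (F.P j) 0 ↥(Matrix.specialUnitaryGroup (Fin 2) ℂ)) (path : List (PBond (F.P j) 0 × (Fin 3 → ℝ))),
            (∀ q ∈ path, ‖q.2‖ ≤ δ) ∧
            (∀ b : PBond (F.P j) 0, path.countP (fun q => decide (q.1 = b)) ≤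
              ⌈1 / (Real.sqrt (θBal F.L γ b₀ p₀ j) / 16)⌉₊ *
                (⌈Real.pi / 2 * (3 * (Real.sqrt (θBal F.L γ b₀ p₀ j) / 16) ^ 2 / 2) / δ⌉₊ + 2)) ∧
            List.foldl (fun (W : GaugeField (F.P j) 0 ↥(Matrix.specialUnitaryGroup (Fin 2) ℂ)) (q : PBond (F.P j) 0 × (Fin 3 → ℝ)) =>
                update W q.1 (W q.1 * expPt q.2)) 1 path = GaugeField.gaugeAct u U ∧
            (∀ m : ℕ, m ≤ path.length → PlaqSmall (θBal F.L γ b₀ p₀ j)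
              (List.foldl (fun (W : GaugeField (F.P j) 0 ↥(Matrix.specialUnitaryGroup (Fin 2) ℂ)) (q : PBond (F.P j) 0 × (Fin 3 → ℝ)) =>
                update W q.1 (W q.1 * expPt q.2)) 1 (path.take m))) ∧
            ∀ m : ℕ, m ≤ path.length → ∀ (b : PBond (F.P j) 0) (w : Fin 3 → ℝ),
              PlaqSmall (θBal F.L γ b₀ p₀ j + 4 * dist1 (expPt w))
                (update (List.foldl (fun (W : GaugeField (F.P j) 0 ↥(Matrix.specialUnitaryGroup (Fin 2) ℂ)) (q : PBond (F.P j) 0 × (Fin 3 → ℝ)) =>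
                  update W q.1 (W q.1 * expPt q.2)) 1 (path.take m)) b
                  ((List.foldl (fun (W : GaugeField (F.P j) 0 ↥(Matrix.specialUnitaryGroup (Fin 2) ℂ)) (q : PBond (F.P j) 0 × (Fin 3 → ℝ)) =>
                    update W q.1 (W q.1 * expPt q.2)) 1 (path.take m)) b * expPt w)) := by
  obtain ⟨pW₁, h₁⟩ := stub_innerWindowGaugeSmall
  obtain ⟨pW₂, h₂⟩ := stub_thresholds
  refine ⟨max pW₁ pW₂, fun p₀ hp F γ b₀ hγ hγ1 hb₀ => ?_⟩
  obtain ⟨jW₁, hj₁⟩ := h₁ p₀ ((le_max_left _ _).trans hp) F γ b₀ hγ hγ1 hb₀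
  obtain ⟨jW₂, hj₂⟩ := h₂ p₀ ((le_max_right _ _).trans hp) F γ b₀ hγ hγ1 hb₀
  refine ⟨max jW₁ jW₂, fun j hj U hU δ hδ _ => ?_⟩
  obtain ⟨hη, hη4, hδθ, -⟩ := hj₂ j ((le_max_right _ _).trans hj)
  obtain ⟨u, hu⟩ := hj₁ j ((le_max_left _ _).trans hj) U hU
  -- names
  set θ : ℝ := θBal F.L γ b₀ p₀ j with hθ
  set θin : ℝ := θBal F.L γ (Real.sqrt b₀) (p₀ / 2) j with hθin
  set η : ℝ := Real.sqrt θ / 16 with hηdef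
  set A : GaugeField (F.P j) 0 ↥(Matrix.specialUnitaryGroup (Fin 2) ℂ) := GaugeField.gaugeAct u U with hAdef
  have hA : PlaqSmall θin A := (B12RegularClassInvariance263.plaqSmall_gaugeAct_iff θin u U).mpr hU
  set a : PBond (F.P j) 0 → ℍ := fun e => su2Quat (A e) - 1 with hadef
  have ha : ∀ e, ‖a e‖ ≤ η := fun e => by
    rw [hadef]; dsimp only; rw [← T4ExpWindowSmallField.dist1_eq_norm_su2Quat_sub_one]; exact (hu e).le
  have ha' : ∀ e, ‖su2Quat (A e) - 1‖ ≤ η := ha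
  have ha1 : ∀ e, ‖1 + a e‖ = 1 := fun e => by rw [hadef]; dsimp only; rw [add_sub_cancel]; exact norm_su2Quat _
  -- the number of sweeps
  set M : ℕ := ⌈1 / η⌉₊ with hMdef
  have hMge : 1 / η ≤ (M : ℝ) := Nat.le_ceil _
  have h4η : 4 ≤ 1 / η := by rw [le_div_iff₀ hη]; linarith
  have hM0 : 0 < M := by
    have : (0 : ℝ) < M := lt_of_lt_of_le (by linarith) hMge
    exact_mod_cast this
  have hMR : (0 : ℝ) < M := by exact_mod_cast hM0
  have hMinv : 1 / (M : ℝ) ≤ η := by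
    rw [div_le_iff₀ hMR]
    have := mul_le_mul_of_nonneg_left hMge hη.le
    rwa [mul_one_div_cancel hη.ne'] at this
  -- the chord configurations
  set C : ℕ → GaugeField (F.P j) 0 ↥(Matrix.specialUnitaryGroup (Fin 2) ℂ) :=
    fun k e => quatToSU2 (1 + ((k : ℝ) / M) • a e) with hC
  have hC0 : C 0 = 1 := by
    funext e
    simp only [hC, Nat.cast_zero, zero_div, zero_smul, add_zero]
    rw [← T4HaarSU2Translate.su2Quat_one, quatToSU2_su2Quat]; rfl
  have hCM : C M = A := by
    funext e
    simp only [hC, div_self hMR.ne', one_smul, hadef, add_sub_cancel, quatToSU2_su2Quat]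
  have hCwin : ∀ k : ℕ, k ≤ M → PlaqSmall (θin + 16 * η ^ 2) (C k) := by
    intro k hk p
    have ht0 : (0 : ℝ) ≤ (k : ℝ) / M := by positivity
    have ht1 : (k : ℝ) / M ≤ 1 := by rw [div_le_one hMR]; exact_mod_cast hk
    have := dist1_plaqHol_chord_le A hη4 ha' ht0 ht1 p
    exact lt_of_le_of_lt this (by linarith [hA p])
  have hCstep : ∀ k : ℕ, k < M → ∀ e, dist1 (C (k + 1) e * (C k e)⁻¹) ≤ 3 * η ^ 2 / 2 := by
    intro k hk e
    have ht0 : (0 : ℝ) ≤ (k : ℝ) / M := by positivity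
    have ht1 : (k : ℝ) / M ≤ 1 := by rw [div_le_one hMR]; exact_mod_cast hk.le
    have ht0' : (0 : ℝ) ≤ ((k + 1 : ℕ) : ℝ) / M := by positivity
    have ht1' : ((k + 1 : ℕ) : ℝ) / M ≤ 1 := by rw [div_le_one hMR]; exact_mod_cast hk
    have h := dist1_chordStep_le (ha1 e) hη4 (ha e) ht0 ht1 ht0' ht1'
    have hdiff : |((k + 1 : ℕ) : ℝ) / M - (k : ℝ) / M| = 1 / M := by
      rw [Nat.cast_succ, ← sub_div, add_sub_cancel_left, abs_of_pos (by positivity)]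
    rw [hdiff] at h
    have : 1 / (M : ℝ) * η ≤ η * η := mul_le_mul_of_nonneg_right hMinv hη.le
    simp only [hC]
    nlinarith [h, this, sq_nonneg η]
  -- induction over the sweeps
  have hs0 : (0 : ℝ) ≤ 3 * η ^ 2 / 2 := by positivity
  set N : ℕ := ⌈Real.pi / 2 * (3 * η ^ 2 / 2) / δ⌉₊ + 2 with hN
  set mv : GaugeField (F.P j) 0 ↥(Matrix.specialUnitaryGroup (Fin 2) ℂ) → PBond (F.P j) 0 × (Fin 3 → ℝ) →
      GaugeField (F.P j) 0 ↥(Matrix.specialUnitaryGroup (Fin 2) ℂ) := fun W q => update W q.1 (W q.1 * expPt q.2) with hmv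
  have hwinθ : θin + 16 * η ^ 2 + 8 * (3 * η ^ 2 / 2) ≤ θ := by nlinarith [hδθ]
  have build : ∀ k : ℕ, k ≤ M → ∃ path : List (PBond (F.P j) 0 × (Fin 3 → ℝ)),
      (∀ q ∈ path, ‖q.2‖ ≤ δ) ∧ (∀ b, path.countP (fun q => decide (q.1 = b)) ≤ k * N) ∧
      List.foldl mv 1 path = C k ∧
      ∀ m : ℕ, m ≤ path.length → PlaqSmall θ (List.foldl mv 1 (path.take m)) := by
    intro k
    induction k with
    | zero =>
      intro _
      refine ⟨[], by simp, by simp, by rw [List.foldl_nil, hC0], ?_⟩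
      intro m _
      rw [List.take_nil, List.foldl_nil, ← hC0]
      exact fun p => (hCwin 0 (Nat.zero_le _) p).trans_le (by nlinarith [hδθ])
    | succ k ih =>
      intro hk
      have hk' : k < M := Nat.lt_of_succ_le hk
      obtain ⟨path, hsz, hcnt, hfold, hpre⟩ := ih hk'.le
      -- the sweep from `C k` to `C (k+1)` with factors `C (k+1) e · (C k e)⁻¹`
      obtain ⟨sw, hsz', hcnt', hfold', hpre'⟩ :=
        exists_sweep_path hs0 hδ (C k) (hCwin k hk'.le) (fun e => C (k + 1) e * (C k e)⁻¹) (hCstep k hk')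
      have htarget : (fun e => C (k + 1) e * (C k e)⁻¹ * C k e) = C (k + 1) := by
        funext e; rw [inv_mul_cancel_right]
      refine ⟨path ++ sw, ?_, ?_, ?_, ?_⟩
      · intro q hq
        rcases List.mem_append.1 hq with hq | hq
        · exact hsz q hq
        · exact hsz' q hq
      · intro b
        rw [List.countP_append, Nat.succ_mul]
        exact add_le_add (hcnt b) (hcnt' b)
      · rw [List.foldl_append, hfold, hmv, hfold', htarget]
      · intro m hm
        by_cases hml : m ≤ path.length
        · rw [List.take_append_of_le_length hml]; exact hpre m hml
        · have hml' : path.length ≤ m := le_of_lt (not_le.1 hml)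
          rw [List.take_append, List.take_of_length_le hml', List.foldl_append, hfold, hmv]
          have hlen : m - path.length ≤ sw.length := by
            rw [List.length_append] at hm; omega
          exact fun p => (hpre' (m - path.length) hlen p).trans_le hwinθ
  obtain ⟨path, hsz, hcnt, hfold, hpre⟩ := build M le_rfl
  refine ⟨u, path, hsz, hcnt, ?_, hpre, ?_⟩
  · rw [hfold, hCM]
  · intro m hm b w
    exact T4ExpWindowSmallField.plaqSmall_of_bdev_le (hpre m hm) fun e => dist1_bdev_update_le _ b (expPt w) e

end Chord

end Summit.QuantumFields.YangMills.Theorems.OrganTangentSmallStepChordPath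

end
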